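import Mathlib
import HarnessLib
import Literature.MathematicalPhysics.QuantumLattice.GrassmannLinearSubstitution
import Literature.MathematicalPhysics.QuantumLattice.GrassmannChargeScaling
import Literature.MathematicalPhysics.QuantumLattice.GrassmannKernels

/-!
# Route `KLProgramme` — crux K3, the nested two-volume pass: the SOURCE-SHIFT algebra of the dead-leg sector (BGM 2006 §2.9 in the tree's `effAction` formalism)
# (cell gate-hubbard-kl, seat hubbard-kl-k3c4-p1 g9; memo VL-OUT-OF-BAND-g9.md §3 (R-src), blueprint VL-INDUCTION-BLUEPRINT-g9.md §B; `--supports` stmt-…-20440)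

The last-scale two-leg kernel read by the VL stub has legs at momenta outside the band of the remaining slices («dead» generators).  BGM 2006 §2.9 carry them as
SOURCES `φ` dressed by the already-integrated covariance: the dressed action `D := 𝒱 ∘ (ψ ↦ ψ_alive + C_{>}φ)` is the image of `𝒱` under a linear substitution `M` that
fixes the alive generators and sends each dead generator into the source block.  Since the single-slice covariance vanishes on dead generators, the step commutes with
the substitution — the algebra behind the recursion `D^{(h−1)} = map τ_h (effAction (C_h ⊕ 0) D^{(h)})` of the blueprint:

* `effAction_map_toLin'` — `effAction C′ (map (toLin′ M) V) = map (toLin′ M) (effAction (Mᵀ C′ M) V)` (`GrassmannLinearSubstitution.effAction_map` for a matrix);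
* **`transpose_mul_blockZero_mul_eq`** — for `M : Γa ⊕ S ← Γ` acting as the identity `Γa ↪ Γ` on the alive block, and `C′ = C ⊕ 0` with `C` supported on alive
  labels: `Mᵀ C′ M = C`; hence **`effAction_blockZero_map_eq`**: `effAction (C ⊕ 0) (map (toLin′ M) V) = map (toLin′ M) (effAction C V)` — sources are spectators;
* `kernel_map_two_inr` — the source–source coefficient of the dressed action: `kernel (map (toLin′ M) V) 2 (inr s, inr t) = Σ_{x,y} M(inr s,x)·M(inr t,y)·kernel V 2 (x,y)`
  (so at a dead momentum it is the two-leg kernel times the dressing `C(ω,k)²`);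
* `sum_pinned_wt_norm_kernel_map_mulLeft_eq` — pinned weighted profiles of a diagonally RESCALED element (`kernel_map_mulLeft`): the dead-leg rescaling `λ` of the
  blueprint multiplies every kernel by `Π_i c(Y_i)` (exact; `effAction_map_mulLeft_of_covariance` commutes it with the step).

Generic; everything proved; no definition.  References: BGM 2006 §2.9 (4.3)–(4.8); Salmhofer 1999 App. B.2.
-/

noncomputable section

namespace Summit.HubbardSuperconductivity.HubbardSuperconductivity.Theorems.TwoVolumeDefect

set_option linter.dupNamespace false -- summit = problem name (single-conjunct summit), D-0017

open Finset Literature.MathematicalPhysics.QuantumLattice GrassmannAlgebra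

variable {𝕜 : Type*} [RCLike 𝕜] {Γ Γ' : Type*} [Fintype Γ] [DecidableEq Γ] [Fintype Γ'] [DecidableEq Γ']

/-! ## §1 The step under a matrix substitution -/

omit [DecidableEq Γ'] in
/-- **`effAction C′ (map (toLin′ M) V) = map (toLin′ M) (effAction (Mᵀ C′ M) V)`** (the covariance of `effAction_map` for a matrix substitution).
[cite: Salmhofer1999, App. B.2 (B.23)-(B.25)] -/
theorem effAction_map_toLin' (M : Matrix Γ' Γ 𝕜) (C' : Matrix Γ' Γ' 𝕜) (V : GrassmannAlgebra 𝕜 Γ) :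
    effAction 𝕜 C' (ExteriorAlgebra.map (Matrix.toLin' M) V) = ExteriorAlgebra.map (Matrix.toLin' M) (effAction 𝕜 (M.transpose * C' * M) V) := by
  rw [effAction_map, LinearMap.toMatrix'_toLin']

/-! ## §2 Alive block identity, dead block into sources: the step commutes with the dressing -/

omit [Fintype Γ] in
/-- **`Mᵀ (C ⊕ 0) M = C`** for a substitution `M : (Γa ⊕ S) ← Γ` that is the identity `Γa ↪ Γ` (via `ι`) on the alive block and sends no alive generator into the
source block, when `C` is supported on alive labels. [folklore] -/
theorem transpose_mul_blockZero_mul_eq {Γa S : Type*} [Fintype Γa] [DecidableEq Γa] [Fintype S] [DecidableEq S]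
    (ι : Γa → Γ) (hι : Function.Injective ι) (M : Matrix (Γa ⊕ S) Γ 𝕜) (C : Matrix Γ Γ 𝕜) (C' : Matrix (Γa ⊕ S) (Γa ⊕ S) 𝕜)
    (hMa : ∀ a x, M (Sum.inl a) x = if x = ι a then 1 else 0)
    (hC'aa : ∀ a b, C' (Sum.inl a) (Sum.inl b) = C (ι a) (ι b)) (hC'as : ∀ a s, C' (Sum.inl a) (Sum.inr s) = 0)
    (hC'sa : ∀ s a, C' (Sum.inr s) (Sum.inl a) = 0) (hC'ss : ∀ s t, C' (Sum.inr s) (Sum.inr t) = 0)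
    (hC : ∀ x y, C x y ≠ 0 → (∃ a, x = ι a) ∧ (∃ b, y = ι b)) :
    M.transpose * C' * M = C := by
  ext x y
  rw [Matrix.mul_apply]
  simp only [Matrix.mul_apply, Matrix.transpose_apply, Fintype.sum_sum_type, hC'as, hC'sa, hC'ss, mul_zero, zero_mul, sum_const_zero,
    add_zero]
  -- only the alive block survives: `Σ_b (Σ_a M (inl a) x * C (ι a) (ι b)) * M (inl b) y`
  simp only [hMa, hC'aa]
  by_cases hx : ∃ a, x = ι a
  · obtain ⟨a, rfl⟩ := hx
    by_cases hy : ∃ b, y = ι b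
    · obtain ⟨b, rfl⟩ := hy
      rw [sum_eq_single b, sum_eq_single a]
      · simp
      · intro a' _ ha'
        rw [if_neg (fun h => ha' (hι h).symm), zero_mul]
      · simp
      · intro b' _ hb'
        rw [if_neg (fun h => hb' (hι h).symm), mul_zero]
      · simp
    · have h0 : C (ι a) y = 0 := by
        by_contra h; exact hy (hC _ _ h).2
      rw [h0]
      refine sum_eq_zero fun b _ => ?_
      rw [if_neg (fun h => hy ⟨b, h⟩), mul_zero]
  · have h0 : C x y = 0 := by
      by_contra h; exact hx (hC _ _ h).1
    rw [h0]
    refine sum_eq_zero fun b _ => ?_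
    rw [sum_eq_zero fun a _ => by rw [if_neg (fun h => hx ⟨a, h⟩), zero_mul], zero_mul]

/-- **THE STEP COMMUTES WITH THE DRESSING OF THE DEAD GENERATORS** (sources are spectators): with `M`, `C`, `C′ = C ⊕ 0` as in `transpose_mul_blockZero_mul_eq`,
`effAction (C ⊕ 0) (map (toLin′ M) V) = map (toLin′ M) (effAction C V)` — BGM 2006 §2.9's inductive representation (4.4) in the tree's formalism.
[cite: BenfattoGiulianiMastropietro2006, §2.9 (4.3)-(4.4)] -/
theorem effAction_blockZero_map_eq {Γa S : Type*} [Fintype Γa] [DecidableEq Γa] [Fintype S] [DecidableEq S]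
    (ι : Γa → Γ) (hι : Function.Injective ι) (M : Matrix (Γa ⊕ S) Γ 𝕜) (C : Matrix Γ Γ 𝕜) (C' : Matrix (Γa ⊕ S) (Γa ⊕ S) 𝕜)
    (hMa : ∀ a x, M (Sum.inl a) x = if x = ι a then 1 else 0)
    (hC'aa : ∀ a b, C' (Sum.inl a) (Sum.inl b) = C (ι a) (ι b)) (hC'as : ∀ a s, C' (Sum.inl a) (Sum.inr s) = 0)
    (hC'sa : ∀ s a, C' (Sum.inr s) (Sum.inl a) = 0) (hC'ss : ∀ s t, C' (Sum.inr s) (Sum.inr t) = 0)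
    (hC : ∀ x y, C x y ≠ 0 → (∃ a, x = ι a) ∧ (∃ b, y = ι b)) (V : GrassmannAlgebra 𝕜 Γ) :
    effAction 𝕜 C' (ExteriorAlgebra.map (Matrix.toLin' M) V) = ExteriorAlgebra.map (Matrix.toLin' M) (effAction 𝕜 C V) := by
  rw [effAction_map_toLin', transpose_mul_blockZero_mul_eq ι hι M C C' hMa hC'aa hC'as hC'sa hC'ss hC]

/-! ## §3 The source–source coefficient and rescaled profiles -/

omit [Fintype Γ'] [DecidableEq Γ'] in
/-- **The two-leg coefficient of a substituted element**: `kernel (map (toLin′ M) V) 2 X′ = Σ_{X} M(X′ 0, X 0)·M(X′ 1, X 1)·kernel V 2 X` (`kernel_map` in degree two).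
At two source labels with `M(inr s, ·)` the dressing row, this is the dressed two-leg kernel of BGM's generating functional. [folklore] -/
theorem kernel_map_two (M : Matrix Γ' Γ 𝕜) (V : GrassmannAlgebra 𝕜 Γ) (X' : Fin 2 → Γ') :
    kernel 𝕜 (ExteriorAlgebra.map (Matrix.toLin' M) V) 2 X' = ∑ X : Fin 2 → Γ, M (X' 0) (X 0) * M (X' 1) (X 1) * kernel 𝕜 V 2 X := by
  rw [kernel_map]
  simp only [LinearMap.toMatrix'_toLin', Fin.prod_univ_two]

/-- **Pinned weighted profiles of a rescaled element**: `Σ_{Y : Y_j = x} ‖kernel (S_c V) m Y‖·w(Y) = Σ_{Y : Y_j = x} (Π_i ‖c(Y_i)‖)·‖kernel V m Y‖·w(Y)`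
(`kernel_map_mulLeft`; the dead-leg rescaling of the blueprint). [folklore] -/
theorem sum_pinned_wt_norm_kernel_map_mulLeft_eq (c : Γ → 𝕜) (V : GrassmannAlgebra 𝕜 Γ) {m : ℕ} (j : Fin m) (x : Γ) (wt : Finset Γ → ℝ) :
    ∑ Y ∈ univ.filter (fun Y : Fin m → Γ => Y j = x), ‖kernel 𝕜 (ExteriorAlgebra.map (LinearMap.mulLeft 𝕜 c) V) m Y‖ * wt (univ.image Y) =
      ∑ Y ∈ univ.filter (fun Y : Fin m → Γ => Y j = x), (∏ i, ‖c (Y i)‖) * ‖kernel 𝕜 V m Y‖ * wt (univ.image Y) := by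
  refine sum_congr rfl fun Y _ => ?_
  rw [kernel_map_mulLeft, norm_mul, norm_prod]

/-- **Rescaling by weights of modulus at most one does not increase a profile** (nonnegative weight `wt`). [folklore] -/
theorem sum_pinned_wt_norm_kernel_map_mulLeft_le (c : Γ → 𝕜) (hc : ∀ y, ‖c y‖ ≤ 1) (V : GrassmannAlgebra 𝕜 Γ) {m : ℕ} (j : Fin m) (x : Γ)
    (wt : Finset Γ → ℝ) (hwt : ∀ S, 0 ≤ wt S) :
    ∑ Y ∈ univ.filter (fun Y : Fin m → Γ => Y j = x), ‖kernel 𝕜 (ExteriorAlgebra.map (LinearMap.mulLeft 𝕜 c) V) m Y‖ * wt (univ.image Y) ≤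
      ∑ Y ∈ univ.filter (fun Y : Fin m → Γ => Y j = x), ‖kernel 𝕜 V m Y‖ * wt (univ.image Y) := by
  rw [sum_pinned_wt_norm_kernel_map_mulLeft_eq]
  refine sum_le_sum fun Y _ => ?_
  have hp : ∏ i, ‖c (Y i)‖ ≤ 1 := prod_le_one (fun i _ => norm_nonneg _) fun i _ => hc _
  have h0 : 0 ≤ ‖kernel 𝕜 V m Y‖ * wt (univ.image Y) := mul_nonneg (norm_nonneg _) (hwt _)
  calc (∏ i, ‖c (Y i)‖) * ‖kernel 𝕜 V m Y‖ * wt (univ.image Y) = (∏ i, ‖c (Y i)‖) * (‖kernel 𝕜 V m Y‖ * wt (univ.image Y)) := by ring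
    _ ≤ 1 * (‖kernel 𝕜 V m Y‖ * wt (univ.image Y)) := mul_le_mul_of_nonneg_right hp h0
    _ = _ := one_mul _

end Summit.HubbardSuperconductivity.HubbardSuperconductivity.Theorems.TwoVolumeDefect

end
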